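import Mathlib
import Summits.CriticalPhenomena.CardyFormulaZ2.Theorems.CardySelfRefinementGradientComparabilityStubWindowAtRhoZero
import Summits.CriticalPhenomena.CardyFormulaZ2.Theorems.CardySelfRefinementGradientComparabilityKernelsDictionary
import Literature.Probability.Percolation.LogDerivativeIntegration
import HarnessLib

/-!
# Kesten's window on the slice `ρ = 0`: Route L — the stub `stub_sliceKesten` from a log-derivative bound

Crux `stmt-CriticalPhenomena-10269`
(`Summit.CriticalPhenomena.CardyFormulaZ2.Theses.CardySelfRefinement.GradientComparability`),
line `monotone-product-coordinates`, stub `stub_sliceKesten` (Kesten's near-critical stability of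
the non-axial pivotal sum `Π(c) = Σ_W μ_{k,c}(e pivotal for Aloc)` of the `k`-periodic
inhomogeneous slice model across the level window `{c : μ_{k,c}(Aloc) ∈ [vlo, vhi]}`).  ROUTE L of
the blueprint `sliceKesten_blueprint.md` (Kesten's own method — Kesten 1987, Lemma 8; Nolin 2008,
§6.1, proof of Thm. 27: "integrate the logarithmic derivative between the two parameters"): the
stub follows by GRÖNWALL ALONG THE LEVEL `g(c) = μ_{k,c}(Aloc) = P_η(0,c)`, whose derivative within
`[0,1]` is `Π(c)` itself (Russo, `hasDerivWithinAt_P_zero`), from the single-parameter bound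
`|Π'(c)| ≤ K · Π(c) · Π(c)` on the level window (a second-moment pivotal estimate AT ONE PARAMETER,
the planner's item K7), with `Λ = e^{max K 0}`: `stub_sliceKesten_of_logDerivBound` (registered
helper, last theorem).

The integration step is the model-free Literature brick
`Literature/Probability/Percolation/LogDerivativeIntegration.lean` (`le_exp_mul_of_abs_derivWithin_le_gauge`:
for real `f, g` with derivatives within `[c, d] ⊇ [a, b]` and `|f'| ≤ K g' f` on `(a, b)`,
`f b ≤ e^{K (g b − g a)} f a` and `f a ≤ e^{K (g b − g a)} f b`), applied with `[c, d] = [0, 1]`,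
`[a, b] = [min c c', max c c']`, `f = Π`, `g = P_η(0,·)`, `g' = Π`.
-/

noncomputable section

namespace Summit.CriticalPhenomena.CardyFormulaZ2.Theorems.CardySelfRefinement

open scoped Topology
open Filter Set MeasureTheory
open Literature.Probability.LatticeModels Literature.Probability.Percolation
open Literature.Probability.Percolation.QuadCrossing
open Summit.CriticalPhenomena.CardyFormulaZ2.Theses.CardySelfRefinement

/-! ## Route L: the stub from the log-derivative bound on the level window -/

/-- **`stub_sliceKesten` from the log-derivative (second-moment) bound `|Π'| ≤ K Π²` on the level
window** (Kesten 1987, Lemma 8; Nolin 2008, §6.1, proof of Thm. 27 — "integrate the logarithmic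
derivative between the two parameters", here along the gauge `g = P_η(0,·)` whose derivative is the
pivotal sum `Π` itself): if for every small mesh the non-axial pivotal sum `Π(s) = Σ_W μ_{k,s}(e
pivotal for Aloc)` has a derivative `Π'(s) = Df s` within `[0,1]` at every `s ∈ [0,1]` with
`|Π'(s)| ≤ K · Π(s) · Π(s)` whenever `s` is in the level window, then `Π(c) ≤ e^{max K 0} Π(c')` for
all `c, c'` in the level window (the window is an interval, `P_mono_c`; Grönwall
`le_exp_mul_of_abs_derivWithin_le_gauge` on `[min c c', max c c'] ⊆ [0,1]`; `0 ≤ g ≤ 1`). -/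
theorem stub_sliceKesten_of_logDerivBound :
    (∀ k : ℕ, k = 2 ∨ k = 3 → ∀ μ : ℝ → Measure (BondConfig (Site 2)),
      (∀ c, μ c = (prodBernoulli fun e : Site 2 × Fin 2 =>
        if ax k e then half else Set.projIcc (0 : ℝ) 1 zero_le_one c).map edgeConfig) →
      ∀ (m : ℕ) (F : Fin m → Quad (Set.univ : Set ℂ)), 0 < m →
        ∀ vlo vhi : ℝ, 0 < vlo → vlo < vhi → vhi < 1 →
          ∃ K η₁ : ℝ, 0 < η₁ ∧ ∀ η ∈ Set.Ioo 0 η₁, ∀ W : Finset (Sym2 (Site 2)),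
            (∀ e, e ∈ W ↔ e ∈ window m F η ∧
              ∃ (v : Site 2) (d : Fin 2), e = edgeOf (v, d) ∧ ¬ ax k (v, d)) →
            ∃ Df : ℝ → ℝ,
              (∀ s ∈ Set.Icc (0 : ℝ) 1, HasDerivWithinAt
                (fun t => ∑ e ∈ W, (μ t).real {ω | IsPivotal (Aloc m F η) e ω}) (Df s) (Set.Icc 0 1) s) ∧
              ∀ s ∈ Set.Icc (0 : ℝ) 1, (μ s).real (Aloc m F η) ∈ Set.Icc vlo vhi →
                |Df s| ≤ K * (∑ e ∈ W, (μ s).real {ω | IsPivotal (Aloc m F η) e ω}) *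
                  ∑ e ∈ W, (μ s).real {ω | IsPivotal (Aloc m F η) e ω}) →
    ∀ k : ℕ, k = 2 ∨ k = 3 → ∀ μ : ℝ → Measure (BondConfig (Site 2)),
      (∀ c, μ c = (prodBernoulli fun e : Site 2 × Fin 2 =>
        if ax k e then half else Set.projIcc (0 : ℝ) 1 zero_le_one c).map edgeConfig) →
      ∀ (m : ℕ) (F : Fin m → Quad (Set.univ : Set ℂ)), 0 < m →
        ∀ vlo vhi : ℝ, 0 < vlo → vlo < vhi → vhi < 1 →
          ∃ Λ η₁ : ℝ, 0 < η₁ ∧ ∀ η ∈ Set.Ioo 0 η₁, ∀ W : Finset (Sym2 (Site 2)),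
            (∀ e, e ∈ W ↔ e ∈ window m F η ∧
              ∃ (v : Site 2) (d : Fin 2), e = edgeOf (v, d) ∧ ¬ ax k (v, d)) →
            ∀ c ∈ Set.Icc (0 : ℝ) 1, ∀ c' ∈ Set.Icc (0 : ℝ) 1,
              (μ c).real (Aloc m F η) ∈ Set.Icc vlo vhi → (μ c').real (Aloc m F η) ∈ Set.Icc vlo vhi →
                ∑ e ∈ W, (μ c).real {ω | IsPivotal (Aloc m F η) e ω} ≤
                  Λ * ∑ e ∈ W, (μ c').real {ω | IsPivotal (Aloc m F η) e ω} := by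
  intro hL k hk μ hμ m F hm vlo vhi hvlo hvv hvhi
  obtain ⟨K, η₁, hη₁, H⟩ := hL k hk μ hμ m F hm vlo vhi hvlo hvv hvhi
  refine ⟨Real.exp (max K 0), η₁, hη₁, fun η hη W hW c hc c' hc' hl hl' => ?_⟩
  have hη0 : η ≠ 0 := hη.1.ne'
  obtain ⟨Df, hDf, hbd⟩ := H η hη W hW
  -- the pivotal sum `f` and the level `g` as real functions of the parameter
  set f : ℝ → ℝ := fun t => ∑ e ∈ W, (μ t).real {ω | IsPivotal (Aloc m F η) e ω} with hf
  set g : ℝ → ℝ := fun t => P k m F η 0 t with hg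
  have hgμ : ∀ t, g t = (μ t).real (Aloc m F η) := fun t => by
    show P k m F η 0 t = (μ t).real (Aloc m F η)
    rw [hμ t, P_zero_eq_real_slice]
  have hf0 : ∀ t, 0 ≤ f t := fun t => Finset.sum_nonneg fun _ _ => measureReal_nonneg
  -- Russo: `g' = f` within `[0,1]`
  have hgd : ∀ s ∈ Set.Icc (0 : ℝ) 1, HasDerivWithinAt g (f s) (Set.Icc 0 1) s := fun s hs => by
    have h := hasDerivWithinAt_P_zero k m F hη0 hs W hW
    refine h.congr_deriv ?_
    simp only [hf, hμ s]
  -- the log-derivative bound on `(a, b)`, `a = min c c'`, `b = max c c'` (inside the level window)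
  have hbound : ∀ s ∈ Set.Ioo (min c c') (max c c'), |Df s| ≤ K * f s * f s := by
    intro s hs
    have hs01 : s ∈ Set.Icc (0 : ℝ) 1 :=
      ⟨(le_min hc.1 hc'.1).trans hs.1.le, hs.2.le.trans (max_le hc.2 hc'.2)⟩
    have hlev : (μ s).real (Aloc m F η) ∈ Set.Icc vlo vhi := by
      rw [← hgμ]
      rcases le_total c c' with hcc | hcc
      · rw [min_eq_left hcc, max_eq_right hcc] at hs
        exact ⟨(show vlo ≤ g c by rw [hgμ]; exact hl.1).trans (P_mono_c k m F hη0 0 hs.1.le),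
          (P_mono_c k m F hη0 0 hs.2.le).trans (show g c' ≤ vhi by rw [hgμ]; exact hl'.2)⟩
      · rw [min_eq_right hcc, max_eq_left hcc] at hs
        exact ⟨(show vlo ≤ g c' by rw [hgμ]; exact hl'.1).trans (P_mono_c k m F hη0 0 hs.1.le),
          (P_mono_c k m F hη0 0 hs.2.le).trans (show g c ≤ vhi by rw [hgμ]; exact hl.2)⟩
    have := hbd s hs01 hlev
    simpa only [hf, mul_assoc] using this
  -- Grönwall along `g` on `[min c c', max c c'] ⊆ [0, 1]`
  have hG := le_exp_mul_of_abs_derivWithin_le_gauge (f := f) (g := g) (f' := Df) (g' := f) (K := K)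
    (le_min hc.1 hc'.1) (min_le_max) (max_le hc.2 hc'.2) hDf hgd hbound
  -- the factor: `K (g b - g a) ≤ max K 0` since `0 ≤ g b - g a ≤ 1`
  have hg01 : ∀ t, 0 ≤ g t ∧ g t ≤ 1 := fun t => by
    haveI := isProbabilityMeasure_M k 0 t
    show 0 ≤ P k m F η 0 t ∧ P k m F η 0 t ≤ 1
    rw [P_eq_real_Aloc]
    exact ⟨measureReal_nonneg, measureReal_le_one⟩
  have hgab : g (min c c') ≤ g (max c c') := P_mono_c k m F hη0 0 min_le_max
  have hexp : Real.exp (K * (g (max c c') - g (min c c'))) ≤ Real.exp (max K 0) := by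
    rw [Real.exp_le_exp]
    have h1 : 0 ≤ g (max c c') - g (min c c') := sub_nonneg.2 hgab
    have h2 : g (max c c') - g (min c c') ≤ 1 := by linarith [(hg01 (max c c')).2, (hg01 (min c c')).1]
    calc K * (g (max c c') - g (min c c')) ≤ max K 0 * (g (max c c') - g (min c c')) :=
          mul_le_mul_of_nonneg_right (le_max_left _ _) h1
      _ ≤ max K 0 * 1 := mul_le_mul_of_nonneg_left h2 (le_max_right _ _)
      _ = max K 0 := mul_one _
  show f c ≤ Real.exp (max K 0) * f c'
  rcases le_total c c' with hcc | hcc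
  · -- `c = a ≤ b = c'`: use `f a ≤ e^{…} f b`
    have h2 := hG.2
    rw [min_eq_left hcc, max_eq_right hcc] at h2 hexp
    exact h2.trans (mul_le_mul_of_nonneg_right hexp (hf0 _))
  · -- `c' = a ≤ b = c`: use `f b ≤ e^{…} f a`
    have h1 := hG.1
    rw [min_eq_right hcc, max_eq_left hcc] at h1 hexp
    exact h1.trans (mul_le_mul_of_nonneg_right hexp (hf0 _))

end Summit.CriticalPhenomena.CardyFormulaZ2.Theorems.CardySelfRefinement

end
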